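import Summits.Ventures.HodgeRepro.Statements
import Summits.Ventures.HodgeRepro.BallModel

/-!
# Statement (c): the Hecke-translate wedge — one self-contained, definition-free proof (seat p3)

Blind re-derivation cell `pub-hodge-repro`, seat `p3`.  Proves the sealed Prop
`Summit.Ventures.HodgeRepro.HeckeTranslateWedge` (Statements.lean §C) on Mathlib and the sealer's
`BallModel.lean` alone, declaring THEOREMS ONLY (no `def` / `abbrev` / `instance`): every auxiliary object
of `HeckeWedgeP3Core.lean` / `HeckeWedgeP3Shell.lean` (elements of `U(2,1)` from a matrix, the origin,
rotations `diag(u, 1)`, boosts, the unitary `u` with `u (r, 0) = a`) is packaged as an existence theorem.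
(A) action laws + chain rule for `Jac`; (B) rotations, boosts, transitivity; (D) the `2×2` wedge algebra;
(E) continuity in the group element + density; (F) assembly.  Nothing here says anything about the
status of the Hodge conjecture for CM abelian varieties, which is NOT proved.
-/

set_option autoImplicit false

open Summit.Ventures.HodgeRepro.BallModel
open Matrix

namespace Summit.Ventures.HodgeRepro.P3Solo

/-! ## (A) Algebra of the action -/

/-- `W3 (g * h) z = mat g *ᵥ W3 h z`. -/
theorem W3_mul (g h : U21) (z : Ball) : W3 (g * h) z = mat g *ᵥ W3 h z := by
  unfold W3; rw [Matrix.mulVec_mulVec]; rfl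

/-- `lift (proj w) = w₂⁻¹ • w`. -/
theorem lift_proj (w : Fin 3 → ℂ) (hw : Q w < 0) : BallModel.lift (proj w hw) = (w 2)⁻¹ • w := by
  have h2 := ne_zero_of_Q_neg hw
  ext i; fin_cases i <;> simp [BallModel.lift, proj, div_eq_inv_mul, h2]

/-- `W3 g (act h z) = (W3 h z 2)⁻¹ • W3 (g * h) z`. -/
theorem W3_act (g h : U21) (z : Ball) : W3 g (act h z) = (W3 h z 2)⁻¹ • W3 (g * h) z := by
  unfold act; rw [W3_mul]; unfold W3; rw [lift_proj, Matrix.mulVec_smul]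

/-- The coordinates of `act g z`: `(W3 g z 0 / W3 g z 2, W3 g z 1 / W3 g z 2)`. -/
theorem act_coe (g : U21) (z : Ball) :
    (act g z).1 = ![W3 g z 0 / W3 g z 2, W3 g z 1 / W3 g z 2] := rfl

/-- The action is a group action: `act (g * h) z = act g (act h z)`. -/
theorem act_mul (g h : U21) (z : Ball) : act (g * h) z = act g (act h z) := by
  have hc : (W3 h z 2)⁻¹ ≠ 0 := inv_ne_zero (W3_2_ne_zero h z)
  apply Subtype.ext; rw [act_coe, act_coe, W3_act]
  ext i; fin_cases i <;> simp [Pi.smul_apply, smul_eq_mul, mul_div_mul_left _ _ hc]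

/-- `W3 1 z = lift z`. -/
theorem W3_one (z : Ball) : W3 1 z = BallModel.lift z := by unfold W3; simp [mat]

/-- `act 1 z = z`. -/
theorem act_one (z : Ball) : act 1 z = z := by
  apply Subtype.ext; rw [act_coe, W3_one]; ext i; fin_cases i <;> simp [BallModel.lift]

/-- `act g⁻¹ (act g z) = z`. -/
theorem act_inv_act (g : U21) (z : Ball) : act g⁻¹ (act g z) = z := by
  rw [← act_mul, inv_mul_cancel, act_one]

/-- **Chain rule** for the Jacobian: `Jac (g * h) z = Jac g (act h z) * Jac h z`. -/
theorem Jac_mul (g h : U21) (z : Ball) : Jac (g * h) z = Jac g (act h z) * Jac h z := by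
  have hW := W3_act g h z
  have hl : W3 h z 2 ≠ 0 := W3_2_ne_zero h z
  have hW2 : W3 (g * h) z 2 ≠ 0 := W3_2_ne_zero (g * h) z
  have hmul : W3 (g * h) z = mat g *ᵥ W3 h z := W3_mul g h z
  have hm : mat (g * h) = mat g * mat h := rfl
  rw [hmul] at hW2
  simp only [Matrix.mulVec, dotProduct, Fin.sum_univ_three] at hW2
  ext i k
  fin_cases i <;> fin_cases k <;>
  · simp only [Jac, Matrix.of_apply, Matrix.mul_apply, Fin.sum_univ_two, hW, Pi.smul_apply,
      smul_eq_mul, hm, Fin.zero_eta, Fin.mk_one, Fin.castSucc_zero, Fin.castSucc_one, Fin.isValue]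
    rw [hmul]
    simp only [Matrix.mulVec, dotProduct, Fin.sum_univ_three]
    field_simp
    ring

/-- `Jac 1 z = 1`. -/
theorem Jac_one (z : Ball) : Jac 1 z = 1 := by
  ext i k; fin_cases i <;> fin_cases k <;> simp [Jac, W3_one, BallModel.lift, mat, Matrix.one_apply]

/-- `Jac g z * Jac g⁻¹ (act g z) = 1`. -/
theorem Jac_mul_inv (g : U21) (z : Ball) : Jac g z * Jac g⁻¹ (act g z) = 1 := by
  have := Jac_mul g g⁻¹ (act g z)
  rw [mul_inv_cancel, Jac_one, act_inv_act] at this; exact this.symm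

/-- The Jacobian is invertible: `det (Jac g z) ≠ 0`. -/
theorem det_Jac_ne_zero (g : U21) (z : Ball) : (Jac g z).det ≠ 0 := by
  intro h; have := congrArg Matrix.det (Jac_mul_inv g z)
  rw [Matrix.det_mul, h, zero_mul, Matrix.det_one] at this; exact zero_ne_one this

/-! ## (B) Explicit elements of `U(2,1)`: rotations, boosts, transitivity -/

/-- A matrix satisfying `gᴴ J g = J` has non-zero determinant. -/
theorem det_ne_zero_of_rel {g : Matrix (Fin 3) (Fin 3) ℂ} (h : gᴴ * BallModel.J * g = BallModel.J) :
    g.det ≠ 0 := by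
  intro hg; have := congrArg Matrix.det h
  rw [Matrix.det_mul, Matrix.det_mul, hg, mul_zero, det_J] at this; norm_num at this

/-- Every matrix satisfying the relation `gᴴ J g = J` is the matrix of an element of `U(2,1)`. -/
theorem exists_mat_eq (g : Matrix (Fin 3) (Fin 3) ℂ) (h : gᴴ * BallModel.J * g = BallModel.J) :
    ∃ k : U21, mat k = g := by
  refine ⟨⟨Matrix.GeneralLinearGroup.mkOfDetNeZero g (det_ne_zero_of_rel h), ?_⟩, ?_⟩
  · change ((Matrix.GeneralLinearGroup.mkOfDetNeZero g (det_ne_zero_of_rel h) : GL3) :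
      Matrix (Fin 3) (Fin 3) ℂ)ᴴ * BallModel.J * _ = BallModel.J
    simpa [Matrix.GeneralLinearGroup.mkOfDetNeZero] using h
  · simp [mat, Matrix.GeneralLinearGroup.mkOfDetNeZero]

/-- The origin `0 ∈ 𝔹²` exists. -/
theorem exists_origin : ∃ z₀ : Ball, z₀.1 = 0 := ⟨⟨0, by simp [nsq]⟩, rfl⟩

/-- `diag(u, 1)` preserves `J` when `u` is unitary. -/
theorem rot_rel {u : Matrix (Fin 2) (Fin 2) ℂ} (hu : uᴴ * u = 1) :
    (!![u 0 0, u 0 1, 0; u 1 0, u 1 1, 0; 0, 0, 1] : Matrix (Fin 3) (Fin 3) ℂ)ᴴ * BallModel.J *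
      !![u 0 0, u 0 1, 0; u 1 0, u 1 1, 0; 0, 0, 1] = BallModel.J := by
  have h00 := congrFun (congrFun hu 0) 0
  have h01 := congrFun (congrFun hu 0) 1
  have h10 := congrFun (congrFun hu 1) 0
  have h11 := congrFun (congrFun hu 1) 1
  simp only [Matrix.mul_apply, Matrix.conjTranspose_apply, Fin.sum_univ_two, Matrix.one_apply, Fin.isValue,
    if_true, Fin.zero_eq_one_iff, if_false, OfNat.ofNat_ne_one, one_ne_zero] at h00 h01 h10 h11
  ext i j
  fin_cases i <;> fin_cases j <;>
  · simp [BallModel.J, Matrix.mul_apply, Fin.sum_univ_three, Matrix.conjTranspose_apply]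
    first
    | exact h00 | exact h01 | exact h10 | exact h11 | skip

/-- The rotation `diag(u, 1) ∈ U(2,1)` exists for unitary `u`. -/
theorem exists_rot (u : Matrix (Fin 2) (Fin 2) ℂ) (hu : uᴴ * u = 1) :
    ∃ k : U21, mat k = !![u 0 0, u 0 1, 0; u 1 0, u 1 1, 0; 0, 0, 1] :=
  exists_mat_eq _ (rot_rel hu)

/-- `W3 k z = (u z, 1)` for a rotation `k` with matrix `diag(u, 1)`. -/
theorem W3_rot {u : Matrix (Fin 2) (Fin 2) ℂ} {k : U21}
    (hk : mat k = !![u 0 0, u 0 1, 0; u 1 0, u 1 1, 0; 0, 0, 1]) (z : Ball) :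
    W3 k z = ![(u *ᵥ z.1) 0, (u *ᵥ z.1) 1, 1] := by
  unfold W3; rw [hk]
  ext i; fin_cases i <;> simp [BallModel.lift, Matrix.mulVec, dotProduct, Fin.sum_univ_three, Fin.sum_univ_two]

/-- A rotation acts linearly: `(act k z).1 = u z`. -/
theorem act_rot_coe {u : Matrix (Fin 2) (Fin 2) ℂ} {k : U21}
    (hk : mat k = !![u 0 0, u 0 1, 0; u 1 0, u 1 1, 0; 0, 0, 1]) (z : Ball) :
    (act k z).1 = u *ᵥ z.1 := by
  rw [act_coe, W3_rot hk]; ext i; fin_cases i <;> simp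

/-- Rotations fix the origin. -/
theorem act_rot_origin {u : Matrix (Fin 2) (Fin 2) ℂ} {k : U21}
    (hk : mat k = !![u 0 0, u 0 1, 0; u 1 0, u 1 1, 0; 0, 0, 1]) {z₀ : Ball} (hz₀ : z₀.1 = 0) :
    act k z₀ = z₀ := by
  apply Subtype.ext; rw [act_rot_coe hk, hz₀, Matrix.mulVec_zero]

/-- The Jacobian of a rotation at the origin is `u`. -/
theorem Jac_rot_origin {u : Matrix (Fin 2) (Fin 2) ℂ} {k : U21}
    (hk : mat k = !![u 0 0, u 0 1, 0; u 1 0, u 1 1, 0; 0, 0, 1]) {z₀ : Ball} (hz₀ : z₀.1 = 0) :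
    Jac k z₀ = u := by
  have hW : W3 k z₀ = ![0, 0, 1] := by
    rw [W3_rot hk, hz₀, Matrix.mulVec_zero]; ext i; fin_cases i <;> simp
  ext i j; simp only [Jac, Matrix.of_apply, hW, hk]; fin_cases i <;> fin_cases j <;> simp

/-- The boost matrix `[[s, 0, r s], [0, 1, 0], [r s, 0, s]]` preserves `J` when `s² (1 - r²) = 1`. -/
theorem boost_rel {r s : ℝ} (hs : s ^ 2 * (1 - r ^ 2) = 1) :
    (!![(s : ℂ), 0, ((r * s : ℝ) : ℂ); 0, 1, 0; ((r * s : ℝ) : ℂ), 0, (s : ℂ)] :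
      Matrix (Fin 3) (Fin 3) ℂ)ᴴ * BallModel.J *
      !![(s : ℂ), 0, ((r * s : ℝ) : ℂ); 0, 1, 0; ((r * s : ℝ) : ℂ), 0, (s : ℂ)] = BallModel.J := by
  have hsC : ((s : ℝ) : ℂ) ^ 2 * (1 - ((r : ℝ) : ℂ) ^ 2) = 1 := by exact_mod_cast hs
  ext i j
  fin_cases i <;> fin_cases j <;>
  · simp [BallModel.J, Matrix.mul_apply, Fin.sum_univ_three, Matrix.conjTranspose_apply]
    try (first | ring1 | (linear_combination hsC) | (linear_combination (-1 : ℂ) * hsC))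

/-- **Boosts**: for `r² < 1` some element of `U(2,1)` moves the origin to `(r, 0)`. -/
theorem exists_boost_origin (r : ℝ) (hr : r ^ 2 < 1) {z₀ : Ball} (hz₀ : z₀.1 = 0) :
    ∃ b : U21, (act b z₀).1 = ![(r : ℂ), 0] := by
  have hpos : 0 < 1 - r ^ 2 := by linarith
  set s : ℝ := 1 / Real.sqrt (1 - r ^ 2) with hs_def
  have hs : s ^ 2 * (1 - r ^ 2) = 1 := by
    rw [hs_def, div_pow, one_pow, Real.sq_sqrt hpos.le, one_div, inv_mul_cancel₀ hpos.ne']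
  have hspos : 0 < s := by rw [hs_def]; positivity
  have hsC : (s : ℂ) ≠ 0 := by exact_mod_cast hspos.ne'
  obtain ⟨b, hb⟩ := exists_mat_eq _ (boost_rel hs)
  have hW : W3 b z₀ = ![((r * s : ℝ) : ℂ), 0, (s : ℂ)] := by
    unfold W3; rw [hb]
    ext i; fin_cases i <;> simp [BallModel.lift, hz₀, Matrix.mulVec, dotProduct, Fin.sum_univ_three]
  refine ⟨b, ?_⟩
  rw [act_coe, hW]; ext i; fin_cases i <;> simp [hsC]

/-- The matrix `[[a₀/r, -ā₁/r], [a₁/r, ā₀/r]]` is unitary when `|a₀|² + |a₁|² = r²`, `r ≠ 0`. -/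
theorem uMat_unitary (a : Fin 2 → ℂ) (r : ℝ) (hr : r ≠ 0) (ha : ‖a 0‖ ^ 2 + ‖a 1‖ ^ 2 = r ^ 2) :
    (!![a 0 / r, -(starRingEnd ℂ) (a 1) / r; a 1 / r, (starRingEnd ℂ) (a 0) / r] :
      Matrix (Fin 2) (Fin 2) ℂ)ᴴ *
      !![a 0 / r, -(starRingEnd ℂ) (a 1) / r; a 1 / r, (starRingEnd ℂ) (a 0) / r] = 1 := by
  have h0 := Complex.conj_mul' (a 0)
  have h1 := Complex.conj_mul' (a 1)
  have hr' : (r : ℂ) ≠ 0 := by exact_mod_cast hr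
  have ha' : ((‖a 0‖ ^ 2 + ‖a 1‖ ^ 2 : ℝ) : ℂ) = ((r ^ 2 : ℝ) : ℂ) := by rw [ha]
  push_cast at ha'
  ext i j
  fin_cases i <;> fin_cases j <;>
  · simp [Matrix.mul_apply, Fin.sum_univ_two, Matrix.conjTranspose_apply]
    field_simp
    try (first | ring1 | (linear_combination h0 + h1 + ha'))

/-- `[[a₀/r, -ā₁/r], [a₁/r, ā₀/r]] (r, 0) = a`. -/
theorem uMat_mulVec (a : Fin 2 → ℂ) (r : ℝ) (hr : r ≠ 0) :
    (!![a 0 / r, -(starRingEnd ℂ) (a 1) / r; a 1 / r, (starRingEnd ℂ) (a 0) / r] :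
      Matrix (Fin 2) (Fin 2) ℂ) *ᵥ ![(r : ℂ), 0] = a := by
  have hr' : (r : ℂ) ≠ 0 := by exact_mod_cast hr
  ext i; fin_cases i <;> simp [Matrix.mulVec, dotProduct, Fin.sum_univ_two, hr']

/-- **Transitivity**: every point of the ball is the image of the origin under some `g ∈ U(2,1)`. -/
theorem exists_act_eq {z₀ : Ball} (hz₀ : z₀.1 = 0) (a : Ball) : ∃ g : U21, act g z₀ = a := by
  by_cases h0 : nsq a.1 = 0
  · refine ⟨1, ?_⟩
    rw [act_one]
    unfold nsq at h0
    obtain ⟨h00, h01⟩ := (add_eq_zero_iff_of_nonneg (by positivity) (by positivity)).1 h0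
    have h00' : a.1 0 = 0 := by simpa using h00
    have h01' : a.1 1 = 0 := by simpa using h01
    apply Subtype.ext; rw [hz₀]; ext i; fin_cases i <;> simp [h00', h01']
  · set r : ℝ := Real.sqrt (nsq a.1) with hr
    have hnsq_nonneg : 0 ≤ nsq a.1 := by unfold nsq; positivity
    have hr2 : r ^ 2 = nsq a.1 := by rw [hr, Real.sq_sqrt hnsq_nonneg]
    have hr1 : r ^ 2 < 1 := by rw [hr2]; exact a.2
    have hrne : r ≠ 0 := by
      intro hz
      rw [hz] at hr2
      exact h0 (by linarith)
    have hu := uMat_unitary a.1 r hrne (by rw [hr2]; rfl)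
    obtain ⟨b, hb⟩ := exists_boost_origin r hr1 hz₀
    obtain ⟨k, hk⟩ := exists_rot _ hu
    refine ⟨k * b, ?_⟩
    rw [act_mul]; apply Subtype.ext; rw [act_rot_coe hk, hb, uMat_mulVec a.1 r hrne]

/-! ## (D) Linear algebra of the wedge -/

/-- `wedge (M x) (M y) = det M · wedge x y`. -/
theorem wedge_mulVec (M : Matrix (Fin 2) (Fin 2) ℂ) (x y : Fin 2 → ℂ) :
    wedge (M *ᵥ x) (M *ᵥ y) = M.det * wedge x y := by
  simp only [wedge, Matrix.mulVec, dotProduct, Fin.sum_univ_two, Matrix.det_fin_two]; ring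

/-- The three vectors `v`, `swap v`, `diag(1,-1) v` cannot all have zero wedge with a non-zero `w`
unless `v = 0`. -/
theorem wedge_ne_zero_of_three {v w : Fin 2 → ℂ} (hv : v ≠ 0) (hw : w ≠ 0) :
    wedge v w ≠ 0 ∨ wedge ![v 1, v 0] w ≠ 0 ∨ wedge ![v 0, -v 1] w ≠ 0 := by
  by_contra hcon
  push Not at hcon
  obtain ⟨h1, h2, h3⟩ := hcon
  simp only [wedge, Matrix.cons_val_zero, Matrix.cons_val_one] at h1 h2 h3
  have e1 : v 0 * w 1 = 0 := by linear_combination (h1 + h3) / 2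
  have e2 : v 1 * w 0 = 0 := by linear_combination (h3 - h1) / 2
  have hv' : v 0 ≠ 0 ∨ v 1 ≠ 0 := by
    by_contra hh
    push Not at hh
    exact hv (funext fun i => by fin_cases i <;> simp [hh.1, hh.2])
  have hw' : w 0 = 0 ∧ w 1 = 0 := by
    rcases hv' with h | h
    · have hw1 : w 1 = 0 := (mul_eq_zero.1 e1).resolve_left h
      refine ⟨(mul_eq_zero.1 ?_).resolve_left h, hw1⟩
      linear_combination -h2 + v 1 * hw1
    · have hw0 : w 0 = 0 := (mul_eq_zero.1 e2).resolve_left h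
      refine ⟨hw0, (mul_eq_zero.1 ?_).resolve_left h⟩
      linear_combination h2 + v 0 * hw0
  exact hw (funext fun i => by fin_cases i <;> simp [hw'.1, hw'.2])

/-! ## (E) Continuity in the group element -/

/-- `g ↦ mat g` is continuous on `U(2,1)` (subspace of the units of the matrix algebra). -/
theorem continuous_mat : Continuous (mat : U21 → Matrix (Fin 3) (Fin 3) ℂ) :=
  Units.continuous_val.comp continuous_subtype_val

/-- `g ↦ W3 g z` is continuous. -/
theorem continuous_W3 (z : Ball) : Continuous fun g : U21 => W3 g z :=
  continuous_mat.matrix_mulVec continuous_const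

/-- `g ↦ W3 g z i` is continuous. -/
theorem continuous_W3_apply (z : Ball) (i : Fin 3) : Continuous fun g : U21 => W3 g z i :=
  (continuous_apply i).comp (continuous_W3 z)

/-- `g ↦ act g z` is continuous. -/
theorem continuous_act (z : Ball) : Continuous fun g : U21 => act g z := by
  have h : Continuous fun g : U21 => ![W3 g z 0 / W3 g z 2, W3 g z 1 / W3 g z 2] := by
    apply continuous_pi; intro i; fin_cases i <;>
      exact (continuous_W3_apply z _).div (continuous_W3_apply z 2) fun g => W3_2_ne_zero g z
  exact h.subtype_mk fun g => (proj (W3 g z) (Q_W3 g z)).2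

/-- `g ↦ Jac g z` is continuous. -/
theorem continuous_Jac (z : Ball) : Continuous fun g : U21 => Jac g z := by
  apply continuous_matrix
  intro i j
  simp only [Jac, Matrix.of_apply]
  refine Continuous.div ?_ ?_ fun g => pow_ne_zero 2 (W3_2_ne_zero g z)
  · exact ((continuous_mat.matrix_elem _ _).mul (continuous_W3_apply z 2)).sub
      ((continuous_W3_apply z _).mul (continuous_mat.matrix_elem _ _))
  · exact (continuous_W3_apply z 2).pow 2

/-- The translate wedge `g ↦ wedge ((Jac g z)ᵀ F (act g z)) (G z)` is continuous in `g` for continuous `F`. -/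
theorem continuous_translateWedge {F : Ball → Fin 2 → ℂ} (hF : Continuous F) (G : Ball → Fin 2 → ℂ)
    (z : Ball) :
    Continuous fun g : U21 => wedge ((Jac g z)ᵀ *ᵥ F (act g z)) (G z) := by
  have h1 : Continuous fun g : U21 => (Jac g z)ᵀ *ᵥ F (act g z) :=
    (continuous_Jac z).matrix_transpose.matrix_mulVec (hF.comp (continuous_act z))
  unfold wedge
  exact (((continuous_apply 0).comp h1).mul continuous_const).sub
    (((continuous_apply 1).comp h1).mul continuous_const)

/-- Density transfer: a continuous function on `U(2,1)` that is non-zero somewhere is non-zero at some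
point of any dense subgroup. -/
theorem exists_mem_ne_zero_of_dense {Δ : Subgroup U21} (hΔ : Dense (Δ : Set U21)) {f : U21 → ℂ}
    (hf : Continuous f) {g₀ : U21} (hg₀ : f g₀ ≠ 0) : ∃ γ ∈ Δ, f γ ≠ 0 := by
  exact hΔ.exists_mem_open (isOpen_ne_fun hf continuous_const) ⟨g₀, hg₀⟩

/-! ## (F) Assembly -/

/-- `act (b₁ * k * b₀⁻¹) z₀ = act b₁ (act k o)` when `act b₀ o = z₀`. -/
theorem act_conj {b₀ b₁ k : U21} {o z₀ : Ball} (h₀ : act b₀ o = z₀) :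
    act (b₁ * k * b₀⁻¹) z₀ = act b₁ (act k o) := by
  rw [act_mul, act_mul, ← h₀, act_inv_act]

/-- `Jac (b₁ * k * b₀⁻¹) z₀ = Jac b₁ (act k o) * Jac k o * Jac b₀⁻¹ z₀` when `act b₀ o = z₀`. -/
theorem Jac_conj {b₀ b₁ k : U21} {o z₀ : Ball} (h₀ : act b₀ o = z₀) :
    Jac (b₁ * k * b₀⁻¹) z₀ = Jac b₁ (act k o) * Jac k o * Jac b₀⁻¹ z₀ := by
  have hz : act b₀⁻¹ z₀ = o := by rw [← h₀, act_inv_act]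
  rw [Jac_mul, hz, Jac_mul]

/-- For an invertible `2×2` matrix `M` and `w ≠ 0` there is `w' ≠ 0` with `M w' = w`. -/
theorem exists_mulVec_eq {M : Matrix (Fin 2) (Fin 2) ℂ} (hM : M.det ≠ 0) {w : Fin 2 → ℂ} (hw : w ≠ 0) :
    ∃ w' : Fin 2 → ℂ, w' ≠ 0 ∧ M *ᵥ w' = w := by
  obtain ⟨w', hw'⟩ := Matrix.mulVec_surjective_iff_isUnit.2
    ((Matrix.isUnit_iff_isUnit_det M).2 (isUnit_iff_ne_zero.2 hM)) w
  exact ⟨w', fun h => hw (by rw [← hw', h, Matrix.mulVec_zero]), hw'⟩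

/-- `M v ≠ 0` for invertible `M` and `v ≠ 0`. -/
theorem mulVec_ne_zero {M : Matrix (Fin 2) (Fin 2) ℂ} (hM : M.det ≠ 0) {v : Fin 2 → ℂ} (hv : v ≠ 0) :
    M *ᵥ v ≠ 0 := fun h => hv <| Matrix.mulVec_injective_iff_isUnit.2
  ((Matrix.isUnit_iff_isUnit_det M).2 (isUnit_iff_ne_zero.2 hM)) (h.trans (Matrix.mulVec_zero M).symm)

/-- **Existence in `U(2,1)`**: some `g ∈ U(2,1)` has a non-zero translate wedge at `z₀`. -/
theorem exists_wedge_ne_zero (F G : Ball → Fin 2 → ℂ) {z₀ z₁ : Ball} (hG : G z₀ ≠ 0) (hF : F z₁ ≠ 0) :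
    ∃ g : U21, wedge ((Jac g z₀)ᵀ *ᵥ F (act g z₀)) (G z₀) ≠ 0 := by
  obtain ⟨o, ho⟩ := exists_origin
  obtain ⟨b₀, hb₀⟩ := exists_act_eq ho z₀
  obtain ⟨b₁, hb₁⟩ := exists_act_eq ho z₁
  set A := Jac b₁ o with hA
  set N := Jac b₀⁻¹ z₀ with hN
  have hAdet : Aᵀ.det ≠ 0 := by rw [Matrix.det_transpose]; exact det_Jac_ne_zero b₁ o
  have hNdet : Nᵀ.det ≠ 0 := by rw [Matrix.det_transpose]; exact det_Jac_ne_zero b₀⁻¹ z₀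
  set v := Aᵀ *ᵥ F z₁ with hv
  have hv0 : v ≠ 0 := mulVec_ne_zero hAdet hF
  obtain ⟨w', hw'0, hw'⟩ := exists_mulVec_eq hNdet hG
  have hsw : (!![(0 : ℂ), 1; 1, 0])ᴴ * !![(0 : ℂ), 1; 1, 0] = 1 := by
    ext i j; fin_cases i <;> fin_cases j <;> simp [Matrix.mul_apply, Fin.sum_univ_two, Matrix.conjTranspose_apply]
  have hdg : (!![(1 : ℂ), 0; 0, -1])ᴴ * !![(1 : ℂ), 0; 0, -1] = 1 := by
    ext i j; fin_cases i <;> fin_cases j <;> simp [Matrix.mul_apply, Fin.sum_univ_two, Matrix.conjTranspose_apply]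
  have hsw' : (!![(0 : ℂ), 1; 1, 0])ᵀ *ᵥ v = ![v 1, v 0] := by
    ext i; fin_cases i <;> simp [Matrix.mulVec, dotProduct, Fin.sum_univ_two]
  have hdg' : (!![(1 : ℂ), 0; 0, -1])ᵀ *ᵥ v = ![v 0, -v 1] := by
    ext i; fin_cases i <;> simp [Matrix.mulVec, dotProduct, Fin.sum_univ_two]
  have key : ∀ (u : Matrix (Fin 2) (Fin 2) ℂ) (k : U21),
      mat k = !![u 0 0, u 0 1, 0; u 1 0, u 1 1, 0; 0, 0, 1] →
      wedge ((Jac (b₁ * k * b₀⁻¹) z₀)ᵀ *ᵥ F (act (b₁ * k * b₀⁻¹) z₀)) (G z₀) =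
        Nᵀ.det * wedge (uᵀ *ᵥ v) w' := by
    intro u k hk
    rw [act_conj hb₀, Jac_conj hb₀, act_rot_origin hk ho, Jac_rot_origin hk ho, hb₁, Matrix.transpose_mul,
      Matrix.transpose_mul, ← hA, ← hN, ← Matrix.mulVec_mulVec, ← Matrix.mulVec_mulVec, ← hv, ← hw',
      wedge_mulVec]
  rcases wedge_ne_zero_of_three hv0 hw'0 with h | h | h
  · obtain ⟨k, hk⟩ := exists_rot 1 (by simp)
    exact ⟨b₁ * k * b₀⁻¹, by
      rw [key 1 k hk, Matrix.transpose_one, Matrix.one_mulVec]; exact mul_ne_zero hNdet h⟩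
  · obtain ⟨k, hk⟩ := exists_rot _ hsw
    exact ⟨b₁ * k * b₀⁻¹, by rw [key _ k hk, hsw']; exact mul_ne_zero hNdet h⟩
  · obtain ⟨k, hk⟩ := exists_rot _ hdg
    exact ⟨b₁ * k * b₀⁻¹, by rw [key _ k hk, hdg']; exact mul_ne_zero hNdet h⟩

end Summit.Ventures.HodgeRepro.P3Solo

namespace Summit.Ventures.HodgeRepro

/-- **(c) The Hecke-translate wedge** — `HeckeTranslateWedge` holds (definition-free self-contained
derivation on Mathlib and `BallModel.lean` alone). -/
theorem heckeTranslateWedge_solo : HeckeTranslateWedge := by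
  intro Δ hΔ F G hF _hG hF0 hG0
  obtain ⟨z₀, hz₀⟩ := Function.ne_iff.1 hG0
  obtain ⟨z₁, hz₁⟩ := Function.ne_iff.1 hF0
  obtain ⟨g₀, hg₀⟩ := P3Solo.exists_wedge_ne_zero F G hz₀ hz₁
  obtain ⟨γ, hγΔ, hγ⟩ :=
    P3Solo.exists_mem_ne_zero_of_dense hΔ (P3Solo.continuous_translateWedge hF G z₀) hg₀
  exact ⟨γ, hγΔ, z₀, hγ⟩

end Summit.Ventures.HodgeRepro
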